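import Summits.BirchSwinnertonDyer.BirchSwinnertonDyer.Theorems.ByReductionTypeAtTwoFineSelmerConjAAtTwoAdditivePotGoodMuTwoKernelRowsA
import Summits.BirchSwinnertonDyer.BirchSwinnertonDyer.Theorems.ByReductionTypeAtTwoFineSelmerConjAAtTwoAdditivePotGoodMuTwoKernelRowsB
import Summits.BirchSwinnertonDyer.BirchSwinnertonDyer.Theorems.ByReductionTypeAtTwoOrdKatoHalfAtTwoIsoConjATwoCubicModelOfClassicalMu
import HarnessLib

/-!
# Route `ByReductionTypeAtTwo` (rung K4), crux C1″ `FineSelmerConjAAtTwoAdditivePotGood` (item stmt-BirchSwinnertonDyer-22615):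
# ASCENT STAMPS, part A (Chevalley no-bit rows) — UNCONDITIONAL (A)₂ (ZERO hypotheses) for the census rows with TWO primes above `2` or EVEN `h`
# and `Δ_cubic < 0`, by Iwasawa's `μ₂ = 0` (kernel certificates) + the `ℓ = 2` ascent to `ℚ(E[2])`
# (a `--supports 22615` file; seat `bsd-2adic-k4-w1` GEN 8, lane (c) of pen RC-472/481; consumer of cruxlead-19573-w2's p728213)

HONEST FRAMING (cell `bsd-2adic`, D-0036/D-0054/D-0152): THEOREMS ONLY (no definition, no named fact, no `sorry`). Each row theorem
`conjA_two_<L>'` is PROVED OUTRIGHT — statement (A) of Coates–Sujatha at `p = 2` for that ONE curve, with no hypothesis and no named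
fact from print (the earlier stamps `conjA_two_<L> hLim2` needed Lim 2017 Thm. 3.5 at `2` DOWNSTAIRS at a real carrier). This is statement
(A), NOT BSD: BSD₂ for these curves is not proved by any of this; C1″ (the `∀`-statement) stays research-open; nothing booked.

MECHANISM (all kernel): (1) `AddKatoTwo.classicalMu_two_<L>` (this seat's p728283/p728288/p728300): Iwasawa's `μ₂ = 0` along the cyclotomic
`ℤ₂`-extensions of the cubic point field `ℚ(θ)` (Chevalley door / capitulation certificate + `n₀ = 0` + Fukuda 1994 Thm. 1 (1); these cubic
fields have TWO primes above `2` or even `h`, outside Iwasawa 1956); (2) cruxlead-19573-w2 GEN 7's door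
`TotallyComplexMu.conjA_two_cubicModel_of_classicalMu_of_discr_neg` (p728213): `Δ_cubic < 0` ⟹ `ℚ(θ)` has one real place (k4-w1 p724162) and
`ℚ(E[2]) = ℚ(θ)(e₂ − e₃)` is totally complex; Iwasawa's `ℓ = 2` ascent with real places (p726686/p727411, unit signatures of the layers
from `ℚ_n`) carries `μ₂ = 0` up to `ℚ(E[2])`; the guarded KERNEL Lim 3.5@2 (p723148) gives (A)₂. The reduced presentation `θ` and
`ℚ(P) = ℚ(β) = ℚ(θ)` are GEN 5–7's; irreducibility of the `2`-division cubic from `[ℚ(β) : ℚ] = 3` (`irreducible_cubic_of_finrank_adjoin_eq_three`).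
Rows here: `237952bv1` (d = -104) · `244416cn1` (d = -804) · `434964b1` (d = -804) · `297264q1` (d = -6756) · `413952bm1` (d = -12936) · `227772e1` (d = -11988).

References: [CoatesSujatha2005] Conj. A, Thm. 3.4; [Iwasawa1973MuInvariants] Thm. 2/3; [Fukuda1994] Thm. 1 (1); [Lim2017FineSelmer] §3;
tree p723148, p726686, p727411, p728213 (w2), p724162, p728283, p728288, p728300 (k4-w1).
-/

set_option autoImplicit false
-- sibling precedent (`…GenusDoorCubic.lean`): the directory name repeats the summit name
set_option linter.dupNamespace false

noncomputable section

open scoped Classical IntermediateField NumberField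

namespace Summit.BirchSwinnertonDyer.BirchSwinnertonDyer.Theorems.AddKatoTwo

open WeierstrassCurve Field Polynomial IsDedekindDomain NumberField Matrix Literature.NumberTheory.EllipticCurves
  Literature.NumberTheory.GaloisRepresentations
  Literature.NumberTheory.IwasawaTheory
  Summit.BirchSwinnertonDyer.BirchSwinnertonDyer.Theorems.SteinbergFibreAtTwo
  Summit.BirchSwinnertonDyer.BirchSwinnertonDyer.Theorems.AlignedTransportAtTwoTorsionPointField
  Summit.BirchSwinnertonDyer.BirchSwinnertonDyer.Theses.ByReductionTypeAtTwo

/-- **A monic integer cubic with a root `β` of degree `3` is irreducible** (`[ℚ(β) : ℚ] = 3` ⟹ the cubic is the minimal polynomial of `β`).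
[folklore] -/
theorem irreducible_cubic_of_finrank_adjoin_eq_three {p q r : ℤ} {β : AlgebraicClosure ℚ}
    (hβ : aeval β (Cubic.toPoly ⟨1, (p : ℚ), q, r⟩) = 0) (h3 : Module.finrank ℚ (IntermediateField.adjoin ℚ {β}) = 3) :
    Irreducible (Cubic.toPoly ⟨1, (p : ℚ), q, r⟩) := by
  have hfm : (Cubic.toPoly ⟨1, (p : ℚ), q, r⟩).Monic := Cubic.monic_of_a_eq_one'
  have hβint : IsIntegral ℚ β := ⟨_, hfm, by rwa [← aeval_def]⟩
  have hdeg : (minpoly ℚ β).natDegree = (Cubic.toPoly ⟨1, (p : ℚ), q, r⟩).natDegree := by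
    rw [← IntermediateField.adjoin.finrank hβint, h3, Cubic.natDegree_of_a_ne_zero' one_ne_zero]
  have heq : Cubic.toPoly ⟨1, (p : ℚ), q, r⟩ = minpoly ℚ β :=
    Polynomial.eq_of_monic_of_dvd_of_natDegree_le (minpoly.monic hβint) hfm (minpoly.dvd ℚ β hβ) hdeg.ge
  rw [heq]
  exact minpoly.irreducible hβint

/-- **UNCONDITIONAL (A)₂ for the census curve `237952bv1` — ZERO hypotheses, ZERO named facts** (Chevalley no-bit row; `2`-torsion cubic field
`ℚ(θ)`, `θ³ + (0)θ² + (-1)θ + (-2) = 0`, `d = -104` < 0, TWO primes above `2` or even `h`). Coates–Sujatha's statement (A) at `p = 2`: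
for every cyclotomic `ℤ₂`-extension of `ℚ` the dual fine Selmer group over `ℚ_∞` is finitely generated over `ℤ₂` (`∃ γ D` currency). KERNEL:
`classicalMu_two_237952bv1` (μ₂(ℚ(θ)_cyc) = 0, GEN 5–7 certificates + Fukuda) ⟹ cruxlead-19573-w2's ℓ = 2 ascent to the totally complex
`ℚ(E[2]) = ℚ(θ, √disc)` and guarded kernel Lim 3.5@2 (`TotallyComplexMu.conjA_two_cubicModel_of_classicalMu_of_discr_neg`, p728213).
UPGRADES `conjA_two_237952bv1 hLim2`. BSD for `237952bv1` is NOT proved by this. [cite: CoatesSujatha2005, Conj. A and Thm. 3.4]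
[cite: Iwasawa1973MuInvariants, Thm. 2 and Thm. 3] [cite: Fukuda1994, Thm. 1 (1), p. 264] -/
theorem conjA_two_237952bv1' (κ : ZpExtension ℚ 2) (hκ : κ.IsCyclotomic) :
    haveI := isElliptic_237952bv1'
    ∃ (γ : absoluteGaloisGroup ℚ) (D : (⟨0, ((0 : ℤ) : ℚ), 0, ((-947226241 : ℤ) : ℚ), ((-11222597935198 : ℤ) : ℚ)⟩ : WeierstrassCurve ℚ).FineSelmerDualData κ γ),
      Module.Finite ℤ_[2] (RestrictScalars ℤ_[2] (IwasawaAlgebra 2) D.X) := by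
  haveI := isElliptic_237952bv1'
  obtain ⟨θ, hθ⟩ : ∃ θ : AlgebraicClosure ℚ, aeval θ (Cubic.toPoly ⟨1, ((0 : ℤ) : ℚ), ((-1 : ℤ) : ℚ), ((-2 : ℤ) : ℚ)⟩) = 0 :=
    IsAlgClosed.exists_aeval_eq_zero _ _ (by rw [Cubic.degree_of_a_ne_zero one_ne_zero]; norm_num)
  have hθ' : θ ^ 3 + (0 : AlgebraicClosure ℚ) * θ ^ 2 + (-1 : AlgebraicClosure ℚ) * θ + (-2 : AlgebraicClosure ℚ) = 0 := by
    have := hθ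
    simp only [Cubic.toPoly, map_one, one_mul, aeval_add, aeval_mul, aeval_C, aeval_X_pow, aeval_X,
      eq_ratCast, Rat.cast_intCast] at this
    push_cast at this
    linear_combination this
  set β : AlgebraicClosure ℚ := algebraMap ℚ (AlgebraicClosure ℚ) (-6032 : ℚ) +
      algebraMap ℚ (AlgebraicClosure ℚ) (13559 : ℚ) * θ + algebraMap ℚ (AlgebraicClosure ℚ) (9048 : ℚ) * θ ^ 2 with hβdef
  have hβ : aeval β (Cubic.toPoly ⟨1, ((0 : ℤ) : ℚ), ((-947226241 : ℤ) : ℚ), ((-11222597935198 : ℤ) : ℚ)⟩) = 0 := by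
    simp only [Cubic.toPoly, map_one, one_mul, aeval_add, aeval_mul, aeval_C, aeval_X_pow, aeval_X, eq_ratCast,
      Rat.cast_intCast]
    rw [hβdef]
    simp only [eq_ratCast]
    push_cast
    linear_combination ((2864201857127 : AlgebraicClosure ℚ) + (4249602561672 : AlgebraicClosure ℚ) * θ + (3330075647808 : AlgebraicClosure ℚ) * θ ^ 2 + (740726318592 : AlgebraicClosure ℚ) * θ ^ 3) * hθ'
  have hadj : IntermediateField.adjoin ℚ {β} = IntermediateField.adjoin ℚ {θ} := by
    apply le_antisymm
    · rw [IntermediateField.adjoin_simple_le_iff, hβdef]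
      have hθmem := IntermediateField.mem_adjoin_simple_self ℚ θ
      exact add_mem (add_mem (algebraMap_mem _ _) (mul_mem (algebraMap_mem _ _) hθmem))
        (mul_mem (algebraMap_mem _ _) (pow_mem hθmem 2))
    · rw [IntermediateField.adjoin_simple_le_iff]
      have hθeq : θ = algebraMap ℚ (AlgebraicClosure ℚ) (-2600668496/44926453 : ℚ) +
          algebraMap ℚ (AlgebraicClosure ℚ) (-926377/584043889 : ℚ) * β +
          algebraMap ℚ (AlgebraicClosure ℚ) (696/7592570557 : ℚ) * β ^ 2 := by
        rw [hβdef]; simp only [eq_ratCast]; push_cast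
        linear_combination (((-1010491776 : AlgebraicClosure ℚ) / 44926453) + ((-337153536 : AlgebraicClosure ℚ) / 44926453) * θ) * hθ'
      rw [hθeq]
      have hβmem := IntermediateField.mem_adjoin_simple_self ℚ β
      exact add_mem (add_mem (algebraMap_mem _ _) (mul_mem (algebraMap_mem _ _) hβmem))
        (mul_mem (algebraMap_mem _ _) (pow_mem hβmem 2))
  have h3 : Module.finrank ℚ (IntermediateField.adjoin ℚ {β}) = 3 := by
    rw [hadj]; exact finrank_adjoin_eq_three_of_irreducible irreducible_cubic_d104n hθ
  exact TotallyComplexMu.conjA_two_cubicModel_of_classicalMu_of_discr_neg (0) (-947226241) (-11222597935198)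
    (irreducible_cubic_of_finrank_adjoin_eq_three hβ h3) (by simp only [Cubic.discr]; norm_num) hβ
    (by rw [hadj]; exact classicalMu_two_237952bv1 hθ) κ hκ

/-- **UNCONDITIONAL (A)₂ for the census curve `244416cn1` — ZERO hypotheses, ZERO named facts** (Chevalley no-bit row; `2`-torsion cubic field
`ℚ(θ)`, `θ³ + (-1)θ² + (4)θ + (-6) = 0`, `d = -804` < 0, TWO primes above `2` or even `h`). Coates–Sujatha's statement (A) at `p = 2`:
for every cyclotomic `ℤ₂`-extension of `ℚ` the dual fine Selmer group over `ℚ_∞` is finitely generated over `ℤ₂` (`∃ γ D` currency). KERNEL: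
`classicalMu_two_244416cn1` (μ₂(ℚ(θ)_cyc) = 0, GEN 5–7 certificates + Fukuda) ⟹ cruxlead-19573-w2's ℓ = 2 ascent to the totally complex
`ℚ(E[2]) = ℚ(θ, √disc)` and guarded kernel Lim 3.5@2 (`TotallyComplexMu.conjA_two_cubicModel_of_classicalMu_of_discr_neg`, p728213).
UPGRADES `conjA_two_244416cn1 hLim2`. BSD for `244416cn1` is NOT proved by this. [cite: CoatesSujatha2005, Conj. A and Thm. 3.4]
[cite: Iwasawa1973MuInvariants, Thm. 2 and Thm. 3] [cite: Fukuda1994, Thm. 1 (1), p. 264] -/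
theorem conjA_two_244416cn1' (κ : ZpExtension ℚ 2) (hκ : κ.IsCyclotomic) :
    haveI := isElliptic_244416cn1'
    ∃ (γ : absoluteGaloisGroup ℚ) (D : (⟨0, ((1 : ℤ) : ℚ), 0, ((-4424231585 : ℤ) : ℚ), ((-113268864408513 : ℤ) : ℚ)⟩ : WeierstrassCurve ℚ).FineSelmerDualData κ γ),
      Module.Finite ℤ_[2] (RestrictScalars ℤ_[2] (IwasawaAlgebra 2) D.X) := by
  haveI := isElliptic_244416cn1'
  obtain ⟨θ, hθ⟩ : ∃ θ : AlgebraicClosure ℚ, aeval θ (Cubic.toPoly ⟨1, ((-1 : ℤ) : ℚ), ((4 : ℤ) : ℚ), ((-6 : ℤ) : ℚ)⟩) = 0 :=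
    IsAlgClosed.exists_aeval_eq_zero _ _ (by rw [Cubic.degree_of_a_ne_zero one_ne_zero]; norm_num)
  have hθ' : θ ^ 3 + (-1 : AlgebraicClosure ℚ) * θ ^ 2 + (4 : AlgebraicClosure ℚ) * θ + (-6 : AlgebraicClosure ℚ) = 0 := by
    have := hθ
    simp only [Cubic.toPoly, map_one, one_mul, aeval_add, aeval_mul, aeval_C, aeval_X_pow, aeval_X,
      eq_ratCast, Rat.cast_intCast] at this
    push_cast at this
    linear_combination this
  set β : AlgebraicClosure ℚ := algebraMap ℚ (AlgebraicClosure ℚ) (37959 : ℚ) +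
      algebraMap ℚ (AlgebraicClosure ℚ) (5892 : ℚ) * θ + algebraMap ℚ (AlgebraicClosure ℚ) (17110 : ℚ) * θ ^ 2 with hβdef
  have hβ : aeval β (Cubic.toPoly ⟨1, ((1 : ℤ) : ℚ), ((-4424231585 : ℤ) : ℚ), ((-113268864408513 : ℤ) : ℚ)⟩) = 0 := by
    simp only [Cubic.toPoly, map_one, one_mul, aeval_add, aeval_mul, aeval_C, aeval_X_pow, aeval_X, eq_ratCast,
      Rat.cast_intCast]
    rw [hβdef]
    simp only [eq_ratCast]
    push_cast
    linear_combination ((37752041782128 : AlgebraicClosure ℚ) + (25267699503520 : AlgebraicClosure ℚ) * θ + (10183674550600 : AlgebraicClosure ℚ) * θ ^ 2 + (5008988431000 : AlgebraicClosure ℚ) * θ ^ 3) * hθ'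
  have hadj : IntermediateField.adjoin ℚ {β} = IntermediateField.adjoin ℚ {θ} := by
    apply le_antisymm
    · rw [IntermediateField.adjoin_simple_le_iff, hβdef]
      have hθmem := IntermediateField.mem_adjoin_simple_self ℚ θ
      exact add_mem (add_mem (algebraMap_mem _ _) (mul_mem (algebraMap_mem _ _) hθmem))
        (mul_mem (algebraMap_mem _ _) (pow_mem hθmem 2))
    · rw [IntermediateField.adjoin_simple_le_iff]
      have hθeq : θ = algebraMap ℚ (AlgebraicClosure ℚ) (-25232812769127/492640816 : ℚ) +
          algebraMap ℚ (AlgebraicClosure ℚ) (-82130073/123160204 : ℚ) * β +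
          algebraMap ℚ (AlgebraicClosure ℚ) (8555/492640816 : ℚ) * β ^ 2 := by
        rw [hβdef]; simp only [eq_ratCast]; push_cast
        linear_combination (((-1057347397175 : AlgebraicClosure ℚ) / 123160204) + ((-626123553875 : AlgebraicClosure ℚ) / 123160204) * θ) * hθ'
      rw [hθeq]
      have hβmem := IntermediateField.mem_adjoin_simple_self ℚ β
      exact add_mem (add_mem (algebraMap_mem _ _) (mul_mem (algebraMap_mem _ _) hβmem))
        (mul_mem (algebraMap_mem _ _) (pow_mem hβmem 2))
  have h3 : Module.finrank ℚ (IntermediateField.adjoin ℚ {β}) = 3 := by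
    rw [hadj]; exact finrank_adjoin_eq_three_of_irreducible irreducible_cubic_d804n hθ
  exact TotallyComplexMu.conjA_two_cubicModel_of_classicalMu_of_discr_neg (1) (-4424231585) (-113268864408513)
    (irreducible_cubic_of_finrank_adjoin_eq_three hβ h3) (by simp only [Cubic.discr]; norm_num) hβ
    (by rw [hadj]; exact classicalMu_two_244416cn1 hθ) κ hκ

/-- **UNCONDITIONAL (A)₂ for the census curve `434964b1` — ZERO hypotheses, ZERO named facts** (Chevalley no-bit row; `2`-torsion cubic field
`ℚ(θ)`, `θ³ + (-1)θ² + (4)θ + (-6) = 0`, `d = -804` < 0, TWO primes above `2` or even `h`). Coates–Sujatha's statement (A) at `p = 2`: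
for every cyclotomic `ℤ₂`-extension of `ℚ` the dual fine Selmer group over `ℚ_∞` is finitely generated over `ℤ₂` (`∃ γ D` currency). KERNEL:
`classicalMu_two_434964b1` (μ₂(ℚ(θ)_cyc) = 0, GEN 5–7 certificates + Fukuda) ⟹ cruxlead-19573-w2's ℓ = 2 ascent to the totally complex
`ℚ(E[2]) = ℚ(θ, √disc)` and guarded kernel Lim 3.5@2 (`TotallyComplexMu.conjA_two_cubicModel_of_classicalMu_of_discr_neg`, p728213).
UPGRADES `conjA_two_434964b1 hLim2`. BSD for `434964b1` is NOT proved by this. [cite: CoatesSujatha2005, Conj. A and Thm. 3.4]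
[cite: Iwasawa1973MuInvariants, Thm. 2 and Thm. 3] [cite: Fukuda1994, Thm. 1 (1), p. 264] -/
theorem conjA_two_434964b1' (κ : ZpExtension ℚ 2) (hκ : κ.IsCyclotomic) :
    haveI := isElliptic_434964b1'
    ∃ (γ : absoluteGaloisGroup ℚ) (D : (⟨0, ((-1 : ℤ) : ℚ), 0, ((-23349300 : ℤ) : ℚ), ((-43419126312 : ℤ) : ℚ)⟩ : WeierstrassCurve ℚ).FineSelmerDualData κ γ),
      Module.Finite ℤ_[2] (RestrictScalars ℤ_[2] (IwasawaAlgebra 2) D.X) := by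
  haveI := isElliptic_434964b1'
  obtain ⟨θ, hθ⟩ : ∃ θ : AlgebraicClosure ℚ, aeval θ (Cubic.toPoly ⟨1, ((-1 : ℤ) : ℚ), ((4 : ℤ) : ℚ), ((-6 : ℤ) : ℚ)⟩) = 0 :=
    IsAlgClosed.exists_aeval_eq_zero _ _ (by rw [Cubic.degree_of_a_ne_zero one_ne_zero]; norm_num)
  have hθ' : θ ^ 3 + (-1 : AlgebraicClosure ℚ) * θ ^ 2 + (4 : AlgebraicClosure ℚ) * θ + (-6 : AlgebraicClosure ℚ) = 0 := by
    have := hθ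
    simp only [Cubic.toPoly, map_one, one_mul, aeval_add, aeval_mul, aeval_C, aeval_X_pow, aeval_X,
      eq_ratCast, Rat.cast_intCast] at this
    push_cast at this
    linear_combination this
  set β : AlgebraicClosure ℚ := algebraMap ℚ (AlgebraicClosure ℚ) (2758 : ℚ) +
      algebraMap ℚ (AlgebraicClosure ℚ) (428 : ℚ) * θ + algebraMap ℚ (AlgebraicClosure ℚ) (1243 : ℚ) * θ ^ 2 with hβdef
  have hβ : aeval β (Cubic.toPoly ⟨1, ((-1 : ℤ) : ℚ), ((-23349300 : ℤ) : ℚ), ((-43419126312 : ℤ) : ℚ)⟩) = 0 := by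
    simp only [Cubic.toPoly, map_one, one_mul, aeval_add, aeval_mul, aeval_C, aeval_X_pow, aeval_X, eq_ratCast,
      Rat.cast_intCast]
    rw [hβdef]
    simp only [eq_ratCast]
    push_cast
    linear_combination ((14474199794 : AlgebraicClosure ℚ) + (9687638708 : AlgebraicClosure ℚ) * θ + (3904338823 : AlgebraicClosure ℚ) * θ ^ 2 + (1920495907 : AlgebraicClosure ℚ) * θ ^ 3) * hθ'
  have hadj : IntermediateField.adjoin ℚ {β} = IntermediateField.adjoin ℚ {θ} := by
    apply le_antisymm
    · rw [IntermediateField.adjoin_simple_le_iff, hβdef]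
      have hθmem := IntermediateField.mem_adjoin_simple_self ℚ θ
      exact add_mem (add_mem (algebraMap_mem _ _) (mul_mem (algebraMap_mem _ _) hθmem))
        (mul_mem (algebraMap_mem _ _) (pow_mem hθmem 2))
    · rw [IntermediateField.adjoin_simple_le_iff]
      have hθeq : θ = algebraMap ℚ (AlgebraicClosure ℚ) (-3224561324/131463 : ℚ) +
          algebraMap ℚ (AlgebraicClosure ℚ) (-3468433/788778 : ℚ) * β +
          algebraMap ℚ (AlgebraicClosure ℚ) (1243/788778 : ℚ) * β ^ 2 := by
        rw [hβdef]; simp only [eq_ratCast]; push_cast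
        linear_combination (((-3243057851 : AlgebraicClosure ℚ) / 788778) + ((-1920495907 : AlgebraicClosure ℚ) / 788778) * θ) * hθ'
      rw [hθeq]
      have hβmem := IntermediateField.mem_adjoin_simple_self ℚ β
      exact add_mem (add_mem (algebraMap_mem _ _) (mul_mem (algebraMap_mem _ _) hβmem))
        (mul_mem (algebraMap_mem _ _) (pow_mem hβmem 2))
  have h3 : Module.finrank ℚ (IntermediateField.adjoin ℚ {β}) = 3 := by
    rw [hadj]; exact finrank_adjoin_eq_three_of_irreducible irreducible_cubic_d804n hθ
  exact TotallyComplexMu.conjA_two_cubicModel_of_classicalMu_of_discr_neg (-1) (-23349300) (-43419126312)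
    (irreducible_cubic_of_finrank_adjoin_eq_three hβ h3) (by simp only [Cubic.discr]; norm_num) hβ
    (by rw [hadj]; exact classicalMu_two_434964b1 hθ) κ hκ

/-- **UNCONDITIONAL (A)₂ for the census curve `297264q1` — ZERO hypotheses, ZERO named facts** (Chevalley no-bit row; `2`-torsion cubic field
`ℚ(θ)`, `θ³ + (0)θ² + (-51)θ + (-148) = 0`, `d = -6756` < 0, TWO primes above `2` or even `h`). Coates–Sujatha's statement (A) at `p = 2`:
for every cyclotomic `ℤ₂`-extension of `ℚ` the dual fine Selmer group over `ℚ_∞` is finitely generated over `ℤ₂` (`∃ γ D` currency). KERNEL: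
`classicalMu_two_297264q1` (μ₂(ℚ(θ)_cyc) = 0, GEN 5–7 certificates + Fukuda) ⟹ cruxlead-19573-w2's ℓ = 2 ascent to the totally complex
`ℚ(E[2]) = ℚ(θ, √disc)` and guarded kernel Lim 3.5@2 (`TotallyComplexMu.conjA_two_cubicModel_of_classicalMu_of_discr_neg`, p728213).
UPGRADES `conjA_two_297264q1 hLim2`. BSD for `297264q1` is NOT proved by this. [cite: CoatesSujatha2005, Conj. A and Thm. 3.4]
[cite: Iwasawa1973MuInvariants, Thm. 2 and Thm. 3] [cite: Fukuda1994, Thm. 1 (1), p. 264] -/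
theorem conjA_two_297264q1' (κ : ZpExtension ℚ 2) (hκ : κ.IsCyclotomic) :
    haveI := isElliptic_297264q1'
    ∃ (γ : absoluteGaloisGroup ℚ) (D : (⟨0, ((-1 : ℤ) : ℚ), 0, ((-80195004 : ℤ) : ℚ), ((-286282093668 : ℤ) : ℚ)⟩ : WeierstrassCurve ℚ).FineSelmerDualData κ γ),
      Module.Finite ℤ_[2] (RestrictScalars ℤ_[2] (IwasawaAlgebra 2) D.X) := by
  haveI := isElliptic_297264q1'
  obtain ⟨θ, hθ⟩ : ∃ θ : AlgebraicClosure ℚ, aeval θ (Cubic.toPoly ⟨1, ((0 : ℤ) : ℚ), ((-51 : ℤ) : ℚ), ((-148 : ℤ) : ℚ)⟩) = 0 :=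
    IsAlgClosed.exists_aeval_eq_zero _ _ (by rw [Cubic.degree_of_a_ne_zero one_ne_zero]; norm_num)
  have hθ' : θ ^ 3 + (0 : AlgebraicClosure ℚ) * θ ^ 2 + (-51 : AlgebraicClosure ℚ) * θ + (-148 : AlgebraicClosure ℚ) = 0 := by
    have := hθ
    simp only [Cubic.toPoly, map_one, one_mul, aeval_add, aeval_mul, aeval_C, aeval_X_pow, aeval_X,
      eq_ratCast, Rat.cast_intCast] at this
    push_cast at this
    linear_combination this
  set β : AlgebraicClosure ℚ := algebraMap ℚ (AlgebraicClosure ℚ) (-2005/3 : ℚ) +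
      algebraMap ℚ (AlgebraicClosure ℚ) (3506/3 : ℚ) * θ + algebraMap ℚ (AlgebraicClosure ℚ) (59/3 : ℚ) * θ ^ 2 with hβdef
  have hβ : aeval β (Cubic.toPoly ⟨1, ((-1 : ℤ) : ℚ), ((-80195004 : ℤ) : ℚ), ((-286282093668 : ℤ) : ℚ)⟩) = 0 := by
    simp only [Cubic.toPoly, map_one, one_mul, aeval_add, aeval_mul, aeval_C, aeval_X_pow, aeval_X, eq_ratCast,
      Rat.cast_intCast]
    rw [hβdef]
    simp only [eq_ratCast]
    push_cast
    linear_combination (((42503850622 : AlgebraicClosure ℚ) / 27) + ((721738681 : AlgebraicClosure ℚ) / 9) * θ + ((12204386 : AlgebraicClosure ℚ) / 9) * θ ^ 2 + ((205379 : AlgebraicClosure ℚ) / 27) * θ ^ 3) * hθ'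
  have hadj : IntermediateField.adjoin ℚ {β} = IntermediateField.adjoin ℚ {θ} := by
    apply le_antisymm
    · rw [IntermediateField.adjoin_simple_le_iff, hβdef]
      have hθmem := IntermediateField.mem_adjoin_simple_self ℚ θ
      exact add_mem (add_mem (algebraMap_mem _ _) (mul_mem (algebraMap_mem _ _) hθmem))
        (mul_mem (algebraMap_mem _ _) (pow_mem hθmem 2))
    · rw [IntermediateField.adjoin_simple_le_iff]
      have hθeq : θ = algebraMap ℚ (AlgebraicClosure ℚ) (1576488812/2357947691 : ℚ) +
          algebraMap ℚ (AlgebraicClosure ℚ) (4077659/4715895382 : ℚ) * β +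
          algebraMap ℚ (AlgebraicClosure ℚ) (-59/4715895382 : ℚ) * β ^ 2 := by
        rw [hβdef]; simp only [eq_ratCast]; push_cast
        linear_combination (((12204386 : AlgebraicClosure ℚ) / 21221529219) + ((205379 : AlgebraicClosure ℚ) / 42443058438) * θ) * hθ'
      rw [hθeq]
      have hβmem := IntermediateField.mem_adjoin_simple_self ℚ β
      exact add_mem (add_mem (algebraMap_mem _ _) (mul_mem (algebraMap_mem _ _) hβmem))
        (mul_mem (algebraMap_mem _ _) (pow_mem hβmem 2))
  have h3 : Module.finrank ℚ (IntermediateField.adjoin ℚ {β}) = 3 := by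
    rw [hadj]; exact finrank_adjoin_eq_three_of_irreducible irreducible_cubic_d6756n hθ
  exact TotallyComplexMu.conjA_two_cubicModel_of_classicalMu_of_discr_neg (-1) (-80195004) (-286282093668)
    (irreducible_cubic_of_finrank_adjoin_eq_three hβ h3) (by simp only [Cubic.discr]; norm_num) hβ
    (by rw [hadj]; exact classicalMu_two_297264q1 hθ) κ hκ

/-- **UNCONDITIONAL (A)₂ for the census curve `413952bm1` — ZERO hypotheses, ZERO named facts** (Chevalley no-bit row; `2`-torsion cubic field
`ℚ(θ)`, `θ³ + (-1)θ² + (-30)θ + (78) = 0`, `d = -12936` < 0, TWO primes above `2` or even `h`). Coates–Sujatha's statement (A) at `p = 2`: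
for every cyclotomic `ℤ₂`-extension of `ℚ` the dual fine Selmer group over `ℚ_∞` is finitely generated over `ℤ₂` (`∃ γ D` currency). KERNEL:
`classicalMu_two_413952bm1` (μ₂(ℚ(θ)_cyc) = 0, GEN 5–7 certificates + Fukuda) ⟹ cruxlead-19573-w2's ℓ = 2 ascent to the totally complex
`ℚ(E[2]) = ℚ(θ, √disc)` and guarded kernel Lim 3.5@2 (`TotallyComplexMu.conjA_two_cubicModel_of_classicalMu_of_discr_neg`, p728213).
UPGRADES `conjA_two_413952bm1 hLim2`. BSD for `413952bm1` is NOT proved by this. [cite: CoatesSujatha2005, Conj. A and Thm. 3.4]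
[cite: Iwasawa1973MuInvariants, Thm. 2 and Thm. 3] [cite: Fukuda1994, Thm. 1 (1), p. 264] -/
theorem conjA_two_413952bm1' (κ : ZpExtension ℚ 2) (hκ : κ.IsCyclotomic) :
    haveI := isElliptic_413952bm1'
    ∃ (γ : absoluteGaloisGroup ℚ) (D : (⟨0, ((-1 : ℤ) : ℚ), 0, ((-134300735 : ℤ) : ℚ), ((-599008857117 : ℤ) : ℚ)⟩ : WeierstrassCurve ℚ).FineSelmerDualData κ γ),
      Module.Finite ℤ_[2] (RestrictScalars ℤ_[2] (IwasawaAlgebra 2) D.X) := by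
  haveI := isElliptic_413952bm1'
  obtain ⟨θ, hθ⟩ : ∃ θ : AlgebraicClosure ℚ, aeval θ (Cubic.toPoly ⟨1, ((-1 : ℤ) : ℚ), ((-30 : ℤ) : ℚ), ((78 : ℤ) : ℚ)⟩) = 0 :=
    IsAlgClosed.exists_aeval_eq_zero _ _ (by rw [Cubic.degree_of_a_ne_zero one_ne_zero]; norm_num)
  have hθ' : θ ^ 3 + (-1 : AlgebraicClosure ℚ) * θ ^ 2 + (-30 : AlgebraicClosure ℚ) * θ + (78 : AlgebraicClosure ℚ) = 0 := by
    have := hθ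
    simp only [Cubic.toPoly, map_one, one_mul, aeval_add, aeval_mul, aeval_C, aeval_X_pow, aeval_X,
      eq_ratCast, Rat.cast_intCast] at this
    push_cast at this
    linear_combination this
  set β : AlgebraicClosure ℚ := algebraMap ℚ (AlgebraicClosure ℚ) (-3901 : ℚ) +
      algebraMap ℚ (AlgebraicClosure ℚ) (-1533 : ℚ) * θ + algebraMap ℚ (AlgebraicClosure ℚ) (217 : ℚ) * θ ^ 2 with hβdef
  have hβ : aeval β (Cubic.toPoly ⟨1, ((-1 : ℤ) : ℚ), ((-134300735 : ℤ) : ℚ), ((-599008857117 : ℤ) : ℚ)⟩) = 0 := by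
    simp only [Cubic.toPoly, map_one, one_mul, aeval_add, aeval_mul, aeval_C, aeval_X_pow, aeval_X, eq_ratCast,
      Rat.cast_intCast]
    rw [hβdef]
    simp only [eq_ratCast]
    push_cast
    linear_combination ((-1724122428 : AlgebraicClosure ℚ) + (1078983675 : AlgebraicClosure ℚ) * θ + (-206343998 : AlgebraicClosure ℚ) * θ ^ 2 + (10218313 : AlgebraicClosure ℚ) * θ ^ 3) * hθ'
  have hadj : IntermediateField.adjoin ℚ {β} = IntermediateField.adjoin ℚ {θ} := by
    apply le_antisymm
    · rw [IntermediateField.adjoin_simple_le_iff, hβdef]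
      have hθmem := IntermediateField.mem_adjoin_simple_self ℚ θ
      exact add_mem (add_mem (algebraMap_mem _ _) (mul_mem (algebraMap_mem _ _) hθmem))
        (mul_mem (algebraMap_mem _ _) (pow_mem hθmem 2))
    · rw [IntermediateField.adjoin_simple_le_iff]
      have hθeq : θ = algebraMap ℚ (AlgebraicClosure ℚ) (925178327/55566 : ℚ) +
          algebraMap ℚ (AlgebraicClosure ℚ) (103678/83349 : ℚ) * β +
          algebraMap ℚ (AlgebraicClosure ℚ) (-31/166698 : ℚ) * β ^ 2 := by
        rw [hβdef]; simp only [eq_ratCast]; push_cast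
        linear_combination (((-391127 : AlgebraicClosure ℚ) / 3402) + ((29791 : AlgebraicClosure ℚ) / 3402) * θ) * hθ'
      rw [hθeq]
      have hβmem := IntermediateField.mem_adjoin_simple_self ℚ β
      exact add_mem (add_mem (algebraMap_mem _ _) (mul_mem (algebraMap_mem _ _) hβmem))
        (mul_mem (algebraMap_mem _ _) (pow_mem hβmem 2))
  have h3 : Module.finrank ℚ (IntermediateField.adjoin ℚ {β}) = 3 := by
    rw [hadj]; exact finrank_adjoin_eq_three_of_irreducible irreducible_cubic_d12936n hθ
  exact TotallyComplexMu.conjA_two_cubicModel_of_classicalMu_of_discr_neg (-1) (-134300735) (-599008857117)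
    (irreducible_cubic_of_finrank_adjoin_eq_three hβ h3) (by simp only [Cubic.discr]; norm_num) hβ
    (by rw [hadj]; exact classicalMu_two_413952bm1 hθ) κ hκ

/-- **UNCONDITIONAL (A)₂ for the census curve `227772e1` — ZERO hypotheses, ZERO named facts** (Chevalley no-bit row; `2`-torsion cubic field
`ℚ(θ)`, `θ³ + (0)θ² + (33)θ + (-76) = 0`, `d = -11988` < 0, TWO primes above `2` or even `h`). Coates–Sujatha's statement (A) at `p = 2`:
for every cyclotomic `ℤ₂`-extension of `ℚ` the dual fine Selmer group over `ℚ_∞` is finitely generated over `ℤ₂` (`∃ γ D` currency). KERNEL: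
`classicalMu_two_227772e1` (μ₂(ℚ(θ)_cyc) = 0, GEN 5–7 certificates + Fukuda) ⟹ cruxlead-19573-w2's ℓ = 2 ascent to the totally complex
`ℚ(E[2]) = ℚ(θ, √disc)` and guarded kernel Lim 3.5@2 (`TotallyComplexMu.conjA_two_cubicModel_of_classicalMu_of_discr_neg`, p728213).
UPGRADES `conjA_two_227772e1 hLim2`. BSD for `227772e1` is NOT proved by this. [cite: CoatesSujatha2005, Conj. A and Thm. 3.4]
[cite: Iwasawa1973MuInvariants, Thm. 2 and Thm. 3] [cite: Fukuda1994, Thm. 1 (1), p. 264] -/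
theorem conjA_two_227772e1' (κ : ZpExtension ℚ 2) (hκ : κ.IsCyclotomic) :
    haveI := isElliptic_227772e1'
    ∃ (γ : absoluteGaloisGroup ℚ) (D : (⟨0, ((0 : ℤ) : ℚ), 0, ((-1754845767 : ℤ) : ℚ), ((-28294794379890 : ℤ) : ℚ)⟩ : WeierstrassCurve ℚ).FineSelmerDualData κ γ),
      Module.Finite ℤ_[2] (RestrictScalars ℤ_[2] (IwasawaAlgebra 2) D.X) := by
  haveI := isElliptic_227772e1'
  obtain ⟨θ, hθ⟩ : ∃ θ : AlgebraicClosure ℚ, aeval θ (Cubic.toPoly ⟨1, ((0 : ℤ) : ℚ), ((33 : ℤ) : ℚ), ((-76 : ℤ) : ℚ)⟩) = 0 :=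
    IsAlgClosed.exists_aeval_eq_zero _ _ (by rw [Cubic.degree_of_a_ne_zero one_ne_zero]; norm_num)
  have hθ' : θ ^ 3 + (0 : AlgebraicClosure ℚ) * θ ^ 2 + (33 : AlgebraicClosure ℚ) * θ + (-76 : AlgebraicClosure ℚ) = 0 := by
    have := hθ
    simp only [Cubic.toPoly, map_one, one_mul, aeval_add, aeval_mul, aeval_C, aeval_X_pow, aeval_X,
      eq_ratCast, Rat.cast_intCast] at this
    push_cast at this
    linear_combination this
  set β : AlgebraicClosure ℚ := algebraMap ℚ (AlgebraicClosure ℚ) (175274/5 : ℚ) +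
      algebraMap ℚ (AlgebraicClosure ℚ) (16286/5 : ℚ) * θ + algebraMap ℚ (AlgebraicClosure ℚ) (7967/5 : ℚ) * θ ^ 2 with hβdef
  have hβ : aeval β (Cubic.toPoly ⟨1, ((0 : ℤ) : ℚ), ((-1754845767 : ℤ) : ℚ), ((-28294794379890 : ℤ) : ℚ)⟩) = 0 := by
    simp only [Cubic.toPoly, map_one, one_mul, aeval_add, aeval_mul, aeval_C, aeval_X_pow, aeval_X, eq_ratCast,
      Rat.cast_intCast]
    rw [hβdef]
    simp only [eq_ratCast]
    push_cast
    linear_combination (((76864895212426 : AlgebraicClosure ℚ) / 125) + ((921085050411 : AlgebraicClosure ℚ) / 5) * θ + ((3101168182362 : AlgebraicClosure ℚ) / 125) * θ ^ 2 + ((505690100063 : AlgebraicClosure ℚ) / 125) * θ ^ 3) * hθ'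
  have hadj : IntermediateField.adjoin ℚ {β} = IntermediateField.adjoin ℚ {θ} := by
    apply le_antisymm
    · rw [IntermediateField.adjoin_simple_le_iff, hβdef]
      have hθmem := IntermediateField.mem_adjoin_simple_self ℚ θ
      exact add_mem (add_mem (algebraMap_mem _ _) (mul_mem (algebraMap_mem _ _) hθmem))
        (mul_mem (algebraMap_mem _ _) (pow_mem hθmem 2))
    · rw [IntermediateField.adjoin_simple_le_iff]
      have hθeq : θ = algebraMap ℚ (AlgebraicClosure ℚ) (1553428469521/19 : ℚ) +
          algebraMap ℚ (AlgebraicClosure ℚ) (64229185/38 : ℚ) * β +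
          algebraMap ℚ (AlgebraicClosure ℚ) (-7967/114 : ℚ) * β ^ 2 := by
        rw [hβdef]; simp only [eq_ratCast]; push_cast
        linear_combination (((1033722727454 : AlgebraicClosure ℚ) / 1425) + ((505690100063 : AlgebraicClosure ℚ) / 2850) * θ) * hθ'
      rw [hθeq]
      have hβmem := IntermediateField.mem_adjoin_simple_self ℚ β
      exact add_mem (add_mem (algebraMap_mem _ _) (mul_mem (algebraMap_mem _ _) hβmem))
        (mul_mem (algebraMap_mem _ _) (pow_mem hβmem 2))
  have h3 : Module.finrank ℚ (IntermediateField.adjoin ℚ {β}) = 3 := by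
    rw [hadj]; exact finrank_adjoin_eq_three_of_irreducible irreducible_cubic_d11988n hθ
  exact TotallyComplexMu.conjA_two_cubicModel_of_classicalMu_of_discr_neg (0) (-1754845767) (-28294794379890)
    (irreducible_cubic_of_finrank_adjoin_eq_three hβ h3) (by simp only [Cubic.discr]; norm_num) hβ
    (by rw [hadj]; exact classicalMu_two_227772e1 hθ) κ hκ

end Summit.BirchSwinnertonDyer.BirchSwinnertonDyer.Theorems.AddKatoTwo

end
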